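import Summits.QuantumFields.BalabanUV.Beta.GAN24.E3SlotDivergence
import Summits.QuantumFields.BalabanUV.Beta.GAN24.WardResidualSUnroll

/-!
# `BalabanUV.Beta.GAN24.BoundaryFluxRecursion` — binder row G-an2-4 ∕ (CONV-C), CT-W ∕ route «QR-LL», the located scalar K-LL-4′ of the OWNER's
# RULING R-gan24p1-g29-1 + A1 (journal l.44562 ∕ l.44793): **THE COARSE BLOCK FLUX OF THE S-STEP IMAGE IS THE RESOLVENT SANDWICH OF THE INPUT's
# FLUX THROUGH THE BIGGER BLOCK — `Σ_{V ∈ box N} divV (e3OfK N K S) (N•Y + V) = −(c_H • mmRead N (K ∘ (Σ_{w ∈ box N²} divV S (N²•Y + w)) ∘ K))`**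
# (road OWNER `b2b-balaban-gan24-p1`, gen 29)

NOT IN PRINT; OUR BOOKKEEPING ([folklore] finite sum of leaf-03 g58's `E3SlotDivergence.divV_e3OfK` over a coarse block + the nested-block
re-indexing `WardResidualSUnroll.sum_box_mul`; 0 `def`, 0 cited facts, 0 `def … : Prop`, 0 sorry).
HONEST FRAMING (cell contract, verbatim): «discharging `BetaPertH` makes Bałaban's UV stability UNCONDITIONAL — a real constructive-QFT result;
it is NOT the continuum limit and NOT the Clay problem.»  HONEST DEPENDENCY (verbatim): «continuum YM on T⁴ ⇐ BetaPertH ∧ nine spine estimates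
(0/9 proved); BetaPertH ⇐ (D1) ∧ (D4) ∧ CAP+tail; G-an2-4 gates asym, D1 and NE2/3/4.»

## Why (RULING A1)
leaf-03's T-EQ for the S-slot map says the level-`j+1` slot divergence of the pushed letter `e3OfK N K S` at a coarse label `y` is `−c_H ×` the resolvent
sandwich of the INPUT's block flux `Φ_{B(y)}(S) = Σ_{v ∈ box} divV S (N•y + v)` — no table leg in it.  Summing over the `N^{d+1}` coarse labels of a
coarse block `B̄ = N•Y + box` (linearity of the sandwich on bounded kernels, leaf-03's `sandwich_finset_sum`) and re-indexing the nested block sum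
(`sum_box_mul`): **the coarse BLOCK FLUX of the image is `−c_H ×` the sandwich of the input's flux through the BIGGER block `B̂ = N²•Y + box (N²)`**.
Consequences read by the OWNER's ruling (NOT typed here): along a PERSISTENT face (the input's face is a face of `B̂`) the flux is transported by the
kernel sandwich alone — `Φ_{j+1} = ρ_Φ·Φ_j`, `ρ_Φ := c_H ×` sandwich gain, the located scalar K-LL-4′; at a non-persistent face `Φ_{B̂}(S) = 0` for a
divergence-total-free letter supported inside `B̂`, so the image is flux-free at the next scale (the pre-registered E32 G3 prediction).
§1 `boxSum_divV_e3OfK` (general decaying `K`, (hH) with constant `c_H`); §2 `boxSum_divV_e3OfK_comb` (the literal's dressed unit comb kernel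
`K♮ᴱ_j`, `c_H = (Lc^{d+1})⁻¹`, via leaf-03's `divV_e3OfK_comb`).
Asserts NOTHING about sizes; decides nothing about (Q-R) ∕ (C) ∕ «T2Shape»; NEVER «G-an2-4 closed» as (CONV-C); NOT D1, NOT `BetaPertH`, NOT continuum,
NOT Clay.  2026-08-22; no existing file touched.
-/

noncomputable section

open Finset
open scoped BigOperators
open Literature.MathematicalPhysics.QuantumFieldTheory
open Literature.MathematicalPhysics.QuantumFieldTheory.Balaban1983to89
open Literature.MathematicalPhysics.QuantumFieldTheory.Balaban1983to89.Beta
open B6BondElimination (unitVec)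
open ExpKernelCalculus (MKer Decays comp)
open OneStepResolventKernel (Fib)
open OneStepKernelFamily (colH KInvStep)
open BalabanStepJetsSucc (mmRead)
open KernelWard (divV Bdd)
open AffineAveraging (box toSite)
open Summit.QuantumFields.BalabanUV.Beta.KernelWardRelative (gaugeWt)
open Summit.QuantumFields.BalabanUV.Beta.SpineRooted (e3OfK)
open Summit.QuantumFields.BalabanUV.Beta.HessKerDressedUnits (unitK)
open Summit.QuantumFields.BalabanUV.Beta.GAN24.CombesThomas (sfStep smStep)
open Summit.QuantumFields.BalabanUV.Beta.AxialDressingRooted (coDressKBmAt)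
open Summit.QuantumFields.BalabanUV.Beta.GAN24.Lin4SlotDivergence (abs_boxSum_divV_le sandwich_finset_sum)
open Summit.QuantumFields.BalabanUV.Beta.GAN24.E3SlotDivergence (divV_e3OfK divV_e3OfK_comb)
open Summit.QuantumFields.BalabanUV.Beta.GAN24.WardResidualSUnroll (sum_box_mul)

namespace Summit.QuantumFields.BalabanUV.Beta.GAN24.BoundaryFluxRecursion

variable {d N : ℕ}

/-! ## §1 General decaying kernel -/

section General

variable {K : MKer (d + 1) (Fib d)} {C δ : ℝ} {S : Fin (d + 1) → (Fin (d + 1) → ℤ) → MKer (d + 1) (Fib d)} {B : ℝ} {cH : ℝ}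

/-- [folklore] The nested block flux of a bounded letter is bounded (leaf-03's `abs_boxSum_divV_le` at a constant family). -/
theorem bdd_boxSum_divV (hS : ∀ κ u x z a b, |S κ u x z a b| ≤ B) (p : Fin (d + 1) → ℤ) :
    Bdd (∑ v ∈ box (d + 1) N, divV S ((N : ℤ) • p + toSite v)) (((box (d + 1) N).card : ℝ) * (((d + 1 : ℕ) : ℝ) * (B + B))) :=
  fun x z a b => abs_boxSum_divV_le (N := N) (T := fun (_ : Fin (d + 1)) (_ : Fin (d + 1) → ℤ) => S) (fun _ _ => hS) p 0 0 x z a b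

/-- NOT IN PRINT; OUR BOOKKEEPING.  **THE COARSE BLOCK FLUX OF THE S-STEP IMAGE** (decaying `K`, rate `δ > 0`, `N ≥ 1`, bounded letter `S`, (hH) with
constant `c_H`): `Σ_{V ∈ box N} divV (e3OfK N K S) (N•Y + toSite V) = −(c_H • mmRead N (K ∘ (Σ_{w ∈ box (N·N)} divV S ((N·N)•Y + toSite w)) ∘ K))`. -/
theorem boxSum_divV_e3OfK (hK : Decays K C δ) (hδ : 0 < δ) (hN : 1 ≤ N) (hS : ∀ κ u x z a b, |S κ u x z a b| ≤ B)
    (hH : ∀ (y : Fin (d + 1) → ℤ) (κ' : Fin (d + 1)) (u : Fin (d + 1) → ℤ),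
      ∑ μ, (colH K N μ (y - unitVec μ) κ' u - colH K N μ y κ' u) = cH * gaugeWt N y κ' u)
    (Y : Fin (d + 1) → ℤ) :
    ∑ V ∈ box (d + 1) N, divV (e3OfK N K S) ((N : ℤ) • Y + toSite V)
      = -(cH • mmRead N (comp (comp K (∑ w ∈ box (d + 1) (N * N), divV S (((N * N : ℕ) : ℤ) • Y + toSite w))) K)) := by
  have hblk : ∀ V : Fin (d + 1) → ℕ,
      Bdd (∑ v ∈ box (d + 1) N, divV S ((N : ℤ) • ((N : ℤ) • Y + toSite V) + toSite v))
        (((box (d + 1) N).card : ℝ) * (((d + 1 : ℕ) : ℝ) * (B + B))) := fun V => bdd_boxSum_divV hS _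
  simp_rw [divV_e3OfK hK hδ hN hS hH]
  rw [Finset.sum_neg_distrib, ← Finset.smul_sum, ← sandwich_finset_sum (box (d + 1) N) hK hδ N hblk,
    sum_box_mul hN N (fun p => divV S p) Y]

end General

/-! ## §2 The literal's dressed unit comb kernel -/

/-- NOT IN PRINT; OUR BOOKKEEPING.  **THE SAME FOR THE DRESSED COMB STEP** (every `j`, every in-block root `r`, every bounded letter `S`; `c_H = (Lc^{d+1})⁻¹`):
`Σ_{V ∈ box Lc} divV (e3OfK Lc K♮ᴱ_j S) (Lc•Y + toSite V) = −((Lc^{d+1})⁻¹ • mmRead Lc (K♮ᴱ_j ∘ (Σ_{w ∈ box (Lc·Lc)} divV S ((Lc·Lc)•Y + toSite w)) ∘ K♮ᴱ_j))`. -/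
theorem boxSum_divV_e3OfK_comb {Lc : ℕ} [NeZero Lc] {r : Fin (d + 1) → ℕ} (hr : r ∈ box (d + 1) Lc) (j : ℕ)
    {S : Fin (d + 1) → (Fin (d + 1) → ℤ) → MKer (d + 1) (Fib d)} {B : ℝ} (hS : ∀ κ u x z a b, |S κ u x z a b| ≤ B) (Y : Fin (d + 1) → ℤ) :
    ∑ V ∈ box (d + 1) Lc, divV (e3OfK Lc (unitK (sfStep Lc j) (smStep d Lc j) (coDressKBmAt (toSite r) Lc (KInvStep (d := d) Lc j))) S)
        ((Lc : ℤ) • Y + toSite V)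
      = -(((Lc : ℝ) ^ (d + 1))⁻¹ • mmRead Lc
          (comp (comp (unitK (sfStep Lc j) (smStep d Lc j) (coDressKBmAt (toSite r) Lc (KInvStep (d := d) Lc j)))
            (∑ w ∈ box (d + 1) (Lc * Lc), divV S (((Lc * Lc : ℕ) : ℤ) • Y + toSite w)))
            (unitK (sfStep Lc j) (smStep d Lc j) (coDressKBmAt (toSite r) Lc (KInvStep (d := d) Lc j))))) := by
  have hLc : 1 ≤ Lc := Nat.one_le_iff_ne_zero.2 (NeZero.ne Lc)
  obtain ⟨δK, CK, hδK, -, hG⟩ := AxialDressingRooted.decays_coDressKBmAt_KInvStep (d := d) hr j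
  have hK := HessKerDressedUnits.decays_unitK (sf := sfStep Lc j) (sm := smStep d Lc j) hG
  have hblk : ∀ V : Fin (d + 1) → ℕ,
      Bdd (∑ v ∈ box (d + 1) Lc, divV S ((Lc : ℤ) • ((Lc : ℤ) • Y + toSite V) + toSite v))
        (((box (d + 1) Lc).card : ℝ) * (((d + 1 : ℕ) : ℝ) * (B + B))) := fun V => bdd_boxSum_divV hS _
  simp_rw [divV_e3OfK_comb hr j hS]
  rw [Finset.sum_neg_distrib, ← Finset.smul_sum, ← sandwich_finset_sum (box (d + 1) Lc) hK hδK Lc hblk,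
    sum_box_mul hLc Lc (fun p => divV S p) Y]

end Summit.QuantumFields.BalabanUV.Beta.GAN24.BoundaryFluxRecursion

end
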